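import Summits.QuantumFields.YangMills.Theorems.AlphaInputsT3ACv3LinearLiftMatrixLift
import Summits.QuantumFields.YangMills.Theorems.AlphaInputsT3ACv3AbelianRegionalLiftCurl
import HarnessLib

/-!
# `AlphaInputsT3ACv3LinearLiftMatrixRegion` — (V) THE MATRIX-VALUED PORT OF THE (LL) ENGINE, PART 3: ★alpha-2's REGIONAL linear lift READ THROUGH (V) — a LINEAR regional
# lift operator (alpha-2's pre-gauge `liftT` with w2's EXPLICIT gauge fix), exact on every level-`k` bond, curl `≤ 4800·ε·L^{−2k}` on the finest squares cornered in `Ω`;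
# its `M_n(ℂ)`∕`𝔰𝔲(N)`-valued port with the SAME constant — cell `ym3-torus`, width seat `ym-ust-19936-w3` (g0); OWNER RULING g24-№4 ∕ DEPMAP v3.5 «linear step =
# `exists_linearLift_region` read through w3's matrix port (V)»

WHY.  RULING g24-№4 (ym3-torus STATUS 2026-08-28T00:44:44Z) supplies the non-abelian (FL) row of 2′∕2′χ by Newton∕IFT whose LINEAR STEP is ★alpha-2 g5's regional lift
(`AbelianEML.Tensor.exists_linearLift_region`, p590670: for a union `Ω` of level-`k` blocks and a level-`k` one-form `A` with `|curl A| ≤ ε` on the level-`k` plaquettes cornered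
in `Ω`, a finest `a` with `linAvgIter k a = A` on EVERY level-`k` bond and `|curl a| ≤ 4800·ε·L^{−2k}` on the finest squares cornered in `Ω`).  A Newton right inverse must be a
MAP with exactness, used on `𝔰𝔲(2)`-valued data; alpha-2's `Tensor.lift` fixes the gauge with a CHOSEN potential (`(linAvgIter_eq_tubeSum_sub_cobd …).choose`), so it is not
linear in `A` as defined.  THIS FILE:
* §6 ★ `segIter_eq_tubeSum` — the bridge between the two scalar engines: w2's iterated segment mean `LinearLiftGauge.segIter s a` IS `(L^s)^{−d}·AbelianEML.tubeSum s a`.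
* §7 ★★ `liftRegion Ω A := Tensor.liftT Ω A − dgrad(−Ψ_k(liftT Ω A) ∘ coarsen_k)` — alpha-2's pre-gauge lift with w2's EXPLICIT gauge fix (`LinearLiftGauge.psiIter`): `segIter_liftT`,
  ★★ `linAvgIter_liftRegion : linAvgIter k (liftRegion Ω A) = A` (EVERY level-`k` bond, w2's `linAvgIter_eq_segIter_sub` + alpha-2's `tubeSum_liftT`), `curlAt_liftRegion`
  (`= curlAt liftT`, so alpha-2's ★★ `abs_curlAt_liftT_le'` applies: `abs_curlAt_liftRegion_le`), LINEARITY (`naive_add∕_smul`, `coef_add∕_smul`, `phi_add∕_smul`,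
  `liftT_add∕_smul`, `liftRegion_add∕_smul`) and the packaging `liftRegionL Ω : (PBond (F.P K) k → ℝ) →ₗ[ℝ] (PBond (F.P K) 0 → ℝ)`; the scalar regional (LL) restated with the
  linear operator: `exists_linearLift_region_linear`.
* §8 the lattice curl as a linear map `curlL` (`byEntry_curlL = curlM`), the corrected duality port `norm_byEntry_le_of_linear_bound'` (hypothesis only for `M ≥ 0`), and ★★
  `liftRegionM Ω A := byEntry (liftRegion Ω) A` for `M_n(ℂ)`-valued data: EXACTNESS `linAvgIterM_liftRegionM` (every level-`k` bond), `liftRegionM_mem` (`𝔰𝔲(N)`-valued on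
  `𝔰𝔲(N)`-valued data; any `ℝ`-submodule), `map_liftRegionM`, ★★ `norm_curlM_liftRegionM_le`: `‖curlM (liftRegionM Ω A) z μ ν‖ ≤ 4800·ε·L^{−2k}` on the finest squares cornered
  in `Ω` from `‖curlM A y α β‖ ≤ ε` on the level-`k` plaquettes cornered in `Ω` — SAME constant as the scalar theorem, NO dimension-of-the-group factor (duality port); ★★★
  `exists_linearLiftM_region` — (LL) for `S`-valued one-forms on a REGION, the matrix twin of alpha-2's theorem and the linear step of RULING g24-№4 in the currency of the
  non-abelian candidates.
HONEST FRAMING.  Finite-dimensional real linear algebra over the lattice tori of [Balaban1987RG1] (0.1)–(0.4) on top of alpha-2's kernel-checked tensor correctors; nothing of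
[Balaban1985UV3]∕[Balaban1985Variational]∕[Balaban1985Averaging] is asserted; (FL) for NON-abelian data, the stub 2′χ `stub_laneRecordsV3Chi`, the crux `HistoryTailL` and any
gap are NOT claimed; a k-UNIFORM SUP bound of the regional lift is NOT here (alpha-2's crossing-bond `naive` carries `A(c)` on one fine bond; a support-aware bound of its gauge
potential is open); count-neutral helper (`--supports stmt-QuantumFields-19936`); registry untouched.  YM₃ on the three-torus is a RUNG of the programme, not the Clay problem;
nothing here is about d = 4, infinite volume or a mass gap.

References: T. Bałaban, Commun. Math. Phys. 102 (1985) 277–309 [Balaban1985Variational] ((2), (3), (8) pp.278–279, (11) p.279); Commun. Math. Phys. 109 (1987) 249–301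
[Balaban1987RG1] ((0.4), (0.11) p.253); B. C. Hall, Lie Groups, Lie Algebras, and Representations (2015) [Hall2015] (Example 7.3).
-/

set_option autoImplicit false

noncomputable section

open scoped Matrix.Norms.L2Operator

namespace Summit.QuantumFields.YangMills.Theorems.LinearLiftMatrix

open Finset
open Literature.MathematicalPhysics.QuantumFieldTheory.Balaban1983to89
open Literature.MathematicalPhysics.QuantumFieldTheory.Balaban1983to89.T3ContinuumYM3Torus
open Literature.MathematicalPhysics.QuantumFieldTheory.Balaban1983to89.B5Eq118OneStroke (iterBlockOf)
open Literature.MathematicalPhysics.QuantumFieldTheory.Balaban1983to89.B10Eq38TorusDomains (toFine)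
open Literature.MathematicalPhysics.QuantumFieldTheory.Balaban1985CMP102.Setting
open Summit.QuantumFields.Balaban3D.Carriers
open Summit.QuantumFields.YangMills.Theorems.AbelianEML (linAvgIter linAvgIter_succ curlAt curlAt_add curlAt_smul tubeSum tubeSum_zero segMean segMean_smul segMean_tubeSum)
open Summit.QuantumFields.YangMills.Theorems.LinearLiftGauge (dgrad psiIter segIter segOp linAvgIter_eq_segIter_sub linAvgIter_dgrad)
open Summit.QuantumFields.YangMills.Theorems.LinearLiftSpread (linAvgIter_sub iterBlockOf_toFine dgrad_neg' curlAt_sub curlAt_dgrad)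
open Summit.QuantumFields.YangMills.Theorems.AbelianEML.Tensor (liftT tubeSum_liftT abs_curlAt_liftT_le' PlaqIn naive coef phi Out host rC e01 e02 e12 le_standing)

/-! ## §6 The bridge between the two scalar engines: `segIter = (L^s)^{−d} · tubeSum` -/

section Bridge

variable {P : Params}

/-- **★ w2's ITERATED SEGMENT MEAN IS alpha-2's NORMALISED TUBE SUM**: `segIter s a c = (L^s)^{−d}·tubeSum s a c` (standing range `s ≤ m + K`; induction on `s` through
alpha-2's `segMean_tubeSum`). [cite: Balaban1987RG1, (0.4)+(0.11) p.253] -/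
theorem segIter_eq_tubeSum : ∀ (s : ℕ), s ≤ P.m + P.K → ∀ (a : PBond P 0 → ℝ) (c : PBond P s),
    segIter s a c = (((P.L : ℝ) ^ s) ^ P.d)⁻¹ * tubeSum s a c
  | 0, _, a, c => by simp [segIter, tubeSum_zero]
  | s + 1, hs, a, c => by
    have ih : segIter s a = fun b => (((P.L : ℝ) ^ s) ^ P.d)⁻¹ * tubeSum s a b := funext fun b => segIter_eq_tubeSum s (Nat.le_of_succ_le hs) a b
    show segMean (segIter s a) c = _
    rw [ih, segMean_smul, segMean_tubeSum hs, pow_succ, mul_pow, mul_inv]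
    ring

end Bridge

/-! ## §7 The LINEAR regional lift: alpha-2's pre-gauge lift with w2's explicit gauge fix -/

section Region

variable {F : T3Family} {K k : ℕ}

/-- **THE LINEAR REGIONAL LIFT** `liftRegion Ω A := liftT Ω A − d(−Ψ_k(liftT Ω A) ∘ coarsen_k)`: alpha-2's naive-plus-correctors lift `Tensor.liftT` (exact TUBE averages on every
level-`k` bond, correctors invisible) followed by w2's explicit pure gauge absorbing the (0.4) coboundary (in place of the chosen potential of `Tensor.lift`).
[cite: Balaban1985Variational, (8)+(11) p.279; Balaban1987RG1, (0.4)+(0.11) p.253] -/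
def liftRegion (Ω : Set (Site (F.P K) 0)) (A : PBond (F.P K) k → ℝ) : PBond (F.P K) 0 → ℝ :=
  liftT F K k Ω A - dgrad (fun x => -psiIter k (liftT F K k Ω A) (iterBlockOf k x))

variable (Ω : Set (Site (F.P K) 0)) (A : PBond (F.P K) k → ℝ)

/-- **EXACT ITERATED SEGMENT MEANS OF `liftT`**: `segIter k (liftT Ω A) c = A c` (`segIter_eq_tubeSum` + alpha-2's `tubeSum_liftT`, `d = 3`).
[cite: Balaban1985Variational, (3)+(8) pp.278–279] -/
theorem segIter_liftT (hk : k ≤ K) (c : PBond (F.P K) k) : segIter k (liftT F K k Ω A) c = A c := by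
  rw [segIter_eq_tubeSum k (le_standing hk), tubeSum_liftT Ω A hk c]
  have hL : ((F.L : ℝ) ^ k) ≠ 0 := pow_ne_zero _ (by exact_mod_cast (zero_lt_one.trans F.hL.2).ne')
  show (((F.L : ℝ) ^ k) ^ 3)⁻¹ * (((F.L : ℝ) ^ k) ^ 3 * A c) = A c
  rw [← mul_assoc, inv_mul_cancel₀ (pow_ne_zero _ hL), one_mul]

/-- **★★ EXACTNESS OF THE LINEAR REGIONAL LIFT ON EVERY LEVEL-`k` BOND**: `linAvgIter k (liftRegion Ω A) = A` (w2's `linAvgIter_eq_segIter_sub` ∕ `linAvgIter_dgrad`: the explicit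
gauge cancels the coboundary; `segIter_liftT`). [cite: Balaban1985Variational, (3)+(8) pp.278–279; Balaban1987RG1, (0.4)+(0.11) p.253] -/
theorem linAvgIter_liftRegion (hk : k ≤ K) : linAvgIter k (liftRegion Ω A) = A := by
  have hseg : segIter k (liftT F K k Ω A) = A := funext fun c => segIter_liftT Ω A hk c
  unfold liftRegion
  rw [linAvgIter_sub, linAvgIter_eq_segIter_sub, hseg, linAvgIter_dgrad]
  have e : ((fun x : Site (F.P K) 0 => -psiIter k (liftT F K k Ω A) (iterBlockOf k x)) ∘ toFine k) = fun y => -psiIter k (liftT F K k Ω A) y := by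
    funext y; simp only [Function.comp, iterBlockOf_toFine k (le_standing hk) y]
  rw [e, dgrad_neg']
  funext b
  simp only [Pi.sub_apply]
  ring

/-- The curl of the linear regional lift is the curl of `liftT` (gradients have no curl). [folklore] -/
theorem curlAt_liftRegion (z : Site (F.P K) 0) (μ ν : Fin 3) : curlAt (liftRegion Ω A) z μ ν = curlAt (liftT F K k Ω A) z μ ν := by
  unfold liftRegion
  rw [curlAt_sub, curlAt_dgrad, sub_zero]

/-- **★★ THE CURL BOUND OF THE LINEAR REGIONAL LIFT UNDER THE REGION** (alpha-2's `abs_curlAt_liftT_le'` read through `curlAt_liftRegion`): `|curl (liftRegion Ω A)(z;μ,ν)| ≤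
4800·ε·L^{−2k}` at every finest square cornered in `Ω`, from `|curl A| ≤ ε` on the level-`k` plaquettes cornered in `Ω`. [cite: Balaban1985Variational, (2)+(8) pp.278–279] -/
theorem abs_curlAt_liftRegion_le (hk : k ≤ K) (hΩ : ∀ w : Site (F.P K) 0, w ∈ Ω ↔ toFine k (coarsen k w) ∈ Ω) {ε : ℝ} (hε : 0 ≤ ε)
    (hA : ∀ (y : Site (F.P K) k) (α β : Fin 3), α ≠ β → PlaqIn F K k Ω y α β → |curlAt A y α β| ≤ ε)
    (z : Site (F.P K) 0) (μ ν : Fin 3) (hμν : μ ≠ ν) (hz : z ∈ Ω) (hzμ : z.shift μ ∈ Ω) (hzν : z.shift ν ∈ Ω) (hzμν : (z.shift μ).shift ν ∈ Ω) :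
    |curlAt (liftRegion Ω A) z μ ν| ≤ 4800 * ε * (((F.L : ℝ) ^ k)⁻¹) ^ 2 := by
  rw [curlAt_liftRegion]
  exact abs_curlAt_liftT_le' Ω A hk hΩ hε hA z μ ν hμν hz hzμ hzν hzμν

/-! ### Linearity -/

variable {Ω A}

/-- The naive crossing-bond lift is additive. [folklore] -/
theorem naive_add (A B : PBond (F.P K) k → ℝ) : naive F K k (A + B) = naive F K k A + naive F K k B := by
  funext b
  simp only [naive, Pi.add_apply]
  split_ifs <;> simp

/-- The naive crossing-bond lift is homogeneous. [folklore] -/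
theorem naive_smul (r : ℝ) (A : PBond (F.P K) k → ℝ) : naive F K k (r • A) = r • naive F K k A := by
  funext b
  simp only [naive, Pi.smul_apply, smul_eq_mul]
  split_ifs <;> simp

/-- The plaquette-corrector coefficient is additive. [folklore] -/
theorem coef_add (Ω : Set (Site (F.P K) 0)) (A B : PBond (F.P K) k → ℝ) (c : Fin 3) (y : Site (F.P K) k) :
    coef F K k Ω (A + B) c y = coef F K k Ω A c y + coef F K k Ω B c y := by
  unfold coef
  split_ifs
  · exact curlAt_add A B y _ _
  · simp

/-- The plaquette-corrector coefficient is homogeneous. [folklore] -/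
theorem coef_smul (Ω : Set (Site (F.P K) 0)) (r : ℝ) (A : PBond (F.P K) k → ℝ) (c : Fin 3) (y : Site (F.P K) k) :
    coef F K k Ω (r • A) c y = r * coef F K k Ω A c y := by
  unfold coef
  split_ifs
  · rw [show r • A = fun b => r * A b from rfl, curlAt_smul]
  · simp

/-- The cube coefficient `φ` is additive. [folklore] -/
theorem phi_add (Ω : Set (Site (F.P K) 0)) (A B : PBond (F.P K) k → ℝ) (y : Site (F.P K) k) :
    phi F K k Ω (A + B) y = phi F K k Ω A y + phi F K k Ω B y := by
  unfold phi
  simp only [coef_add]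
  ring

/-- The cube coefficient `φ` is homogeneous. [folklore] -/
theorem phi_smul (Ω : Set (Site (F.P K) 0)) (r : ℝ) (A : PBond (F.P K) k → ℝ) (y : Site (F.P K) k) :
    phi F K k Ω (r • A) y = r * phi F K k Ω A y := by
  unfold phi
  simp only [coef_smul]
  ring

open scoped Classical in
/-- **alpha-2's PRE-GAUGE LIFT `liftT` IS ADDITIVE IN THE DATUM** (the correctors' profiles do not depend on `A`; their coefficients are linear). [cite: Balaban1985Variational, (8) p.279] -/
theorem liftT_add (Ω : Set (Site (F.P K) 0)) (A B : PBond (F.P K) k → ℝ) : liftT F K k Ω (A + B) = liftT F K k Ω A + liftT F K k Ω B := by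
  funext b
  have h2 : ∀ y : Site (F.P K) k,
      coef F K k Ω (A + B) 0 y * e01 F K k y b + coef F K k Ω (A + B) 1 y * e02 F K k y b + coef F K k Ω (A + B) 2 y * e12 F K k y b =
        (coef F K k Ω A 0 y * e01 F K k y b + coef F K k Ω A 1 y * e02 F K k y b + coef F K k Ω A 2 y * e12 F K k y b) +
          (coef F K k Ω B 0 y * e01 F K k y b + coef F K k Ω B 1 y * e02 F K k y b + coef F K k Ω B 2 y * e12 F K k y b) := fun y => by
    simp only [coef_add]; ring
  have h3 : ∀ y : Site (F.P K) k, (if Out F K k Ω y then phi F K k Ω (A + B) y else 0) * rC F K k (host F K k Ω y) y b =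
      (if Out F K k Ω y then phi F K k Ω A y else 0) * rC F K k (host F K k Ω y) y b +
        (if Out F K k Ω y then phi F K k Ω B y else 0) * rC F K k (host F K k Ω y) y b := fun y => by
    split_ifs
    · rw [phi_add, add_mul]
    · simp
  simp only [liftT, Pi.add_apply, naive_add, h2, h3, sum_add_distrib]
  ring

open scoped Classical in
/-- **alpha-2's PRE-GAUGE LIFT `liftT` IS HOMOGENEOUS IN THE DATUM.** [cite: Balaban1985Variational, (8) p.279] -/
theorem liftT_smul (Ω : Set (Site (F.P K) 0)) (r : ℝ) (A : PBond (F.P K) k → ℝ) : liftT F K k Ω (r • A) = r • liftT F K k Ω A := by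
  funext b
  have h2 : ∀ y : Site (F.P K) k,
      coef F K k Ω (r • A) 0 y * e01 F K k y b + coef F K k Ω (r • A) 1 y * e02 F K k y b + coef F K k Ω (r • A) 2 y * e12 F K k y b =
        r * (coef F K k Ω A 0 y * e01 F K k y b + coef F K k Ω A 1 y * e02 F K k y b + coef F K k Ω A 2 y * e12 F K k y b) := fun y => by
    simp only [coef_smul]; ring
  have h3 : ∀ y : Site (F.P K) k, (if Out F K k Ω y then phi F K k Ω (r • A) y else 0) * rC F K k (host F K k Ω y) y b =
      r * ((if Out F K k Ω y then phi F K k Ω A y else 0) * rC F K k (host F K k Ω y) y b) := fun y => by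
    split_ifs
    · rw [phi_smul, mul_assoc]
    · simp
  simp only [liftT, Pi.smul_apply, smul_eq_mul, naive_smul, h2, h3, ← mul_sum]
  ring

/-- **THE LINEAR REGIONAL LIFT IS ADDITIVE.** [cite: Balaban1987RG1, (0.4)+(0.11) p.253] -/
theorem liftRegion_add (Ω : Set (Site (F.P K) 0)) (A B : PBond (F.P K) k → ℝ) : liftRegion Ω (A + B) = liftRegion Ω A + liftRegion Ω B := by
  unfold liftRegion
  rw [liftT_add, psiIter_add]
  funext b
  simp only [Pi.add_apply, Pi.sub_apply, dgrad]
  ring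

/-- **THE LINEAR REGIONAL LIFT IS HOMOGENEOUS.** [cite: Balaban1987RG1, (0.4)+(0.11) p.253] -/
theorem liftRegion_smul (Ω : Set (Site (F.P K) 0)) (r : ℝ) (A : PBond (F.P K) k → ℝ) : liftRegion Ω (r • A) = r • liftRegion Ω A := by
  unfold liftRegion
  rw [liftT_smul, psiIter_smul]
  funext b
  simp only [Pi.smul_apply, Pi.sub_apply, dgrad, smul_eq_mul]
  ring

/-- **THE LINEAR REGIONAL LIFT AS AN `ℝ`-LINEAR MAP** `Ω¹(T^{(k)}) → Ω¹(T^{(0)})`. [cite: Balaban1987RG1, (0.4)+(0.11) p.253] -/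
def liftRegionL (Ω : Set (Site (F.P K) 0)) (k : ℕ) : (PBond (F.P K) k → ℝ) →ₗ[ℝ] (PBond (F.P K) 0 → ℝ) where
  toFun := liftRegion Ω
  map_add' := liftRegion_add Ω
  map_smul' := liftRegion_smul Ω

/-- `liftRegionL` is `liftRegion`. [cite: Balaban1987RG1, (0.4)+(0.11) p.253] -/
@[simp] theorem liftRegionL_apply (Ω : Set (Site (F.P K) 0)) (A : PBond (F.P K) k → ℝ) : liftRegionL Ω k A = liftRegion Ω A := rfl

/-- **(LL) WITH A LINEAR OPERATOR** — alpha-2's `exists_linearLift_region` restated with the witness `liftRegion Ω A` (a linear map of `A`). [cite: Balaban1985Variational, (2)+(3)+(8) pp.278–279] -/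
theorem exists_linearLift_region_linear (hk : k ≤ K) (Ω : Set (Site (F.P K) 0)) (hΩ : ∀ w : Site (F.P K) 0, w ∈ Ω ↔ toFine k (coarsen k w) ∈ Ω) :
    ∃ R : (PBond (F.P K) k → ℝ) →ₗ[ℝ] (PBond (F.P K) 0 → ℝ), ∀ (A : PBond (F.P K) k → ℝ), linAvgIter k (R A) = A ∧
      ∀ {ε : ℝ}, 0 ≤ ε → (∀ (y : Site (F.P K) k) (α β : Fin 3), α ≠ β → PlaqIn F K k Ω y α β → |curlAt A y α β| ≤ ε) →
        ∀ (z : Site (F.P K) 0) (μ ν : Fin 3), μ ≠ ν → z ∈ Ω → z.shift μ ∈ Ω → z.shift ν ∈ Ω → (z.shift μ).shift ν ∈ Ω →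
          |curlAt (R A) z μ ν| ≤ 4800 * ε * (((F.L : ℝ) ^ k)⁻¹) ^ 2 :=
  ⟨liftRegionL Ω k, fun A => ⟨linAvgIter_liftRegion Ω A hk, fun hε hA z μ ν hμν hz hzμ hzν hzμν =>
    abs_curlAt_liftRegion_le Ω A hk hΩ hε hA z μ ν hμν hz hzμ hzν hzμν⟩⟩

end Region

/-! ## §8 The matrix-valued regional lift -/

section CurlLinear

variable {P : Params} {j : ℕ} {n : Type*}

/-- **THE LATTICE CURL AS AN `ℝ`-LINEAR MAP** `Ω¹(T^{(j)}) → (sites × direction pairs → ℝ)`. [cite: Balaban1985Averaging, (9) p.19] -/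
def curlL (P : Params) (j : ℕ) : (PBond P j → ℝ) →ₗ[ℝ] (Site P j × Fin P.d × Fin P.d → ℝ) where
  toFun a p := curlAt a p.1 p.2.1 p.2.2
  map_add' a b := by funext p; exact curlAt_add a b p.1 p.2.1 p.2.2
  map_smul' r a := by funext p; simp only [RingHom.id_apply, Pi.smul_apply, smul_eq_mul]; exact curlAt_smul r a p.1 p.2.1 p.2.2

/-- `curlL` unfolded. [cite: Balaban1985Averaging, (9) p.19] -/
@[simp] theorem curlL_apply (a : PBond P j → ℝ) (p : Site P j × Fin P.d × Fin P.d) : curlL P j a p = curlAt a p.1 p.2.1 p.2.2 := rfl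

/-- **THE ENTRYWISE EXTENSION OF THE CURL IS THE MATRIX CURL**: `byEntry curlL A (x, μ, ν) = curlM A x μ ν`. [cite: Balaban1985Averaging, (9) p.19] -/
theorem byEntry_curlL (A : PBond P j → Matrix n n ℂ) (p : Site P j × Fin P.d × Fin P.d) :
    byEntry (curlL P j) A p = curlM A p.1 p.2.1 p.2.2 := by
  ext i l
  apply Complex.ext
  · rw [byEntry_apply_re, curlM_apply_re]; rfl
  · rw [byEntry_apply_im, curlM_apply_im]; rfl

variable {ι ι' κ : Type*} [Fintype ι] [DecidableEq ι] [Fintype n] [DecidableEq n]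

/-- **THE DUALITY PORT, HYPOTHESIS ONLY FOR NON-NEGATIVE BOUNDS** (the usable form when the scalar supplier assumes `0 ≤ ε`): same statement as
`norm_byEntry_le_of_linear_bound` with `0 ≤ M` throughout. [folklore] -/
theorem norm_byEntry_le_of_linear_bound' (T : (ι → ℝ) →ₗ[ℝ] (κ → ℝ)) (G : (ι → ℝ) →ₗ[ℝ] (ι' → ℝ)) (N : ι' → Prop) (b : κ) {C : ℝ}
    (hT : ∀ (f : ι → ℝ) (M : ℝ), 0 ≤ M → (∀ y, N y → |G f y| ≤ M) → |T f b| ≤ C * M)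
    (A : ι → Matrix n n ℂ) {M : ℝ} (hM : 0 ≤ M) (hA : ∀ y, N y → ‖byEntry G A y‖ ≤ M) :
    ‖byEntry T A b‖ ≤ C * M := by
  obtain ⟨g, hg1, hgx⟩ := exists_dual_vector'' ℝ (byEntry T A b)
  have hgle : ∀ Z : Matrix n n ℂ, |g Z| ≤ ‖Z‖ := fun Z => by
    rw [← Real.norm_eq_abs]
    exact (g.le_opNorm Z).trans (by nlinarith [norm_nonneg Z])
  have hyp : ∀ y, N y → |G (fun c => g (A c)) y| ≤ M := fun y hy => by
    rw [show G (fun c => g (A c)) y = g (byEntry G A y) from (apply_byEntry G (g : Matrix n n ℂ →ₗ[ℝ] ℝ) A y).symm]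
    exact (hgle _).trans (hA y hy)
  have h := hT _ M hM hyp
  rw [show T (fun c => g (A c)) b = g (byEntry T A b) from (apply_byEntry T (g : Matrix n n ℂ →ₗ[ℝ] ℝ) A b).symm] at h
  have hx : (g (byEntry T A b) : ℝ) = ‖byEntry T A b‖ := by simpa using hgx
  calc ‖byEntry T A b‖ = g (byEntry T A b) := hx.symm
    _ ≤ |g (byEntry T A b)| := le_abs_self _
    _ ≤ C * M := h

end CurlLinear

section MatrixRegion

variable {F : T3Family} {K k : ℕ} {n : Type*}

/-- **THE MATRIX-VALUED REGIONAL LIFT**: `liftRegion Ω` on the real and imaginary part of every entry. [cite: Balaban1985Variational, (8) p.279; Balaban1987RG1, (0.4)+(0.11) p.253] -/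
def liftRegionM (Ω : Set (Site (F.P K) 0)) (A : PBond (F.P K) k → Matrix n n ℂ) : PBond (F.P K) 0 → Matrix n n ℂ := byEntry (liftRegion Ω) A

variable (Ω : Set (Site (F.P K) 0))

/-- `liftRegionM` is `byEntry (liftRegion Ω)`. [cite: Balaban1987RG1, (0.4)+(0.11) p.253] -/
theorem liftRegionM_eq (A : PBond (F.P K) k → Matrix n n ℂ) : liftRegionM Ω A = byEntry (liftRegion Ω) A := rfl

/-- **★★ EXACTNESS OF THE MATRIX REGIONAL LIFT ON EVERY LEVEL-`k` BOND**: `linAvgIterM k (liftRegionM Ω A) = A`. [cite: Balaban1985Variational, (3)+(8) pp.278–279] -/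
theorem linAvgIterM_liftRegionM [Fintype n] [DecidableEq n] [Nonempty n] (hk : k ≤ K) (A : PBond (F.P K) k → Matrix n n ℂ) :
    linAvgIterM k (liftRegionM Ω A) = A := by
  rw [linAvgIterM_eq_byEntry, liftRegionM_eq, byEntry_comp]
  have h : ((linAvgIter k) ∘ (liftRegion Ω) : (PBond (F.P K) k → ℝ) → (PBond (F.P K) k → ℝ)) = id := funext fun f => linAvgIter_liftRegion Ω f hk
  rw [h, byEntry_id]

/-- **★ `𝔰𝔲(N)`-VALUED DATA LIFT TO `𝔰𝔲(N)`-VALUED FIELDS** (any `ℝ`-submodule). [cite: Hall2015, Example 7.3] -/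
theorem liftRegionM_mem (S : Submodule ℝ (Matrix n n ℂ)) {A : PBond (F.P K) k → Matrix n n ℂ} (hA : ∀ c, A c ∈ S) (b : PBond (F.P K) 0) :
    liftRegionM Ω A b ∈ S := by
  classical
  rw [liftRegionM_eq, byEntry_congr (T := liftRegion Ω) (fun f => (liftRegionL_apply Ω f).symm)]
  exact byEntry_mem (liftRegionL Ω k) S hA b

/-- The matrix regional lift commutes with every `ℝ`-linear endomorphism of the coefficients applied pointwise. [folklore] -/
theorem map_liftRegionM (ψ : Matrix n n ℂ →ₗ[ℝ] Matrix n n ℂ) (A : PBond (F.P K) k → Matrix n n ℂ) (b : PBond (F.P K) 0) :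
    ψ (liftRegionM Ω A b) = liftRegionM Ω (fun c => ψ (A c)) b := by
  classical
  rw [liftRegionM_eq, liftRegionM_eq, byEntry_congr (T := liftRegion Ω) (fun f => (liftRegionL_apply Ω f).symm),
    byEntry_congr (T := liftRegion Ω) (fun f => (liftRegionL_apply Ω f).symm)]
  exact map_byEntry_eq (liftRegionL Ω k) ψ A b

/-- **★★ THE CURL BOUND OF THE MATRIX REGIONAL LIFT UNDER THE REGION, SAME CONSTANT, NO GROUP-DIMENSION FACTOR**: from `‖curlM A (y; α, β)‖ ≤ ε` on the level-`k` plaquettes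
cornered in `Ω`, `‖curlM (liftRegionM Ω A) (z; μ, ν)‖ ≤ 4800·ε·L^{−2k}` at every finest square cornered in `Ω` (the scalar bound read through the duality port with
`T = curl ∘ liftRegion`, `G = curl`). [cite: Balaban1985Variational, (2)+(8) pp.278–279] -/
theorem norm_curlM_liftRegionM_le [Fintype n] [DecidableEq n] (hk : k ≤ K) (hΩ : ∀ w : Site (F.P K) 0, w ∈ Ω ↔ toFine k (coarsen k w) ∈ Ω)
    (A : PBond (F.P K) k → Matrix n n ℂ) {ε : ℝ} (hε : 0 ≤ ε)
    (hA : ∀ (y : Site (F.P K) k) (α β : Fin 3), α ≠ β → PlaqIn F K k Ω y α β → ‖curlM A y α β‖ ≤ ε)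
    (z : Site (F.P K) 0) (μ ν : Fin 3) (hμν : μ ≠ ν) (hz : z ∈ Ω) (hzμ : z.shift μ ∈ Ω) (hzν : z.shift ν ∈ Ω) (hzμν : (z.shift μ).shift ν ∈ Ω) :
    ‖curlM (liftRegionM Ω A) z μ ν‖ ≤ (4800 * (((F.L : ℝ) ^ k)⁻¹) ^ 2) * ε := by
  classical
  -- the matrix curl of the matrix lift is the entrywise extension of `curl ∘ liftRegion`
  have hT : byEntry ((curlL (F.P K) 0).comp (liftRegionL Ω k)) A (z, μ, ν) = curlM (liftRegionM Ω A) z μ ν := by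
    rw [LinearMap.coe_comp, byEntry_congr (T := ⇑(curlL (F.P K) 0) ∘ ⇑(liftRegionL Ω k)) (T' := ⇑(curlL (F.P K) 0) ∘ liftRegion Ω) (fun f => rfl),
      ← byEntry_comp, ← liftRegionM_eq, byEntry_curlL]
  rw [← hT]
  refine norm_byEntry_le_of_linear_bound' ((curlL (F.P K) 0).comp (liftRegionL Ω k)) (curlL (F.P K) k)
    (fun p => p.2.1 ≠ p.2.2 ∧ PlaqIn F K k Ω p.1 p.2.1 p.2.2) (z, μ, ν) (fun f M hM hf => ?_) A hε (fun p hp => ?_)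
  · -- the scalar bound for `f`
    rw [LinearMap.comp_apply, curlL_apply, liftRegionL_apply]
    have hf' : ∀ (y : Site (F.P K) k) (α β : Fin 3), α ≠ β → PlaqIn F K k Ω y α β → |curlAt f y α β| ≤ M :=
      fun y α β hαβ hP => by have h := hf (y, α, β) ⟨hαβ, hP⟩; rw [curlL_apply] at h; exact h
    have h := abs_curlAt_liftRegion_le Ω f hk hΩ hM hf' z μ ν hμν hz hzμ hzν hzμν
    simpa [mul_comm, mul_assoc, mul_left_comm] using h
  · rw [byEntry_curlL]
    exact hA p.1 p.2.1 p.2.2 hp.1 hp.2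

/-- **★★★ (LL) FOR `S`-VALUED ONE-FORMS ON A REGION** — the matrix twin of ★alpha-2's `exists_linearLift_region` and the LINEAR STEP of RULING g24-№4 in the currency of the
non-abelian candidates: for every union `Ω` of level-`k` blocks, every `ℝ`-submodule `S` of `M_n(ℂ)` (e.g. `𝔰𝔲(N)`) and every `S`-valued level-`k` one-form `A` with
`‖curlM A‖ ≤ ε` on the level-`k` plaquettes cornered in `Ω`, the `S`-valued finest one-form `liftRegionM Ω A` has EXACT `k`-fold matrix linearised (0.4) averages `A` on every
level-`k` bond and `‖curlM‖ ≤ 4800·ε·L^{−2k}` at every finest square cornered in `Ω`; the lift is LINEAR in `A`. [cite: Balaban1985Variational, (2)+(3)+(8) pp.278–279] -/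
theorem exists_linearLiftM_region [Fintype n] [DecidableEq n] [Nonempty n] (hk : k ≤ K) (hΩ : ∀ w : Site (F.P K) 0, w ∈ Ω ↔ toFine k (coarsen k w) ∈ Ω)
    (S : Submodule ℝ (Matrix n n ℂ)) (A : PBond (F.P K) k → Matrix n n ℂ) (hAS : ∀ c, A c ∈ S) {ε : ℝ} (hε : 0 ≤ ε)
    (hA : ∀ (y : Site (F.P K) k) (α β : Fin 3), α ≠ β → PlaqIn F K k Ω y α β → ‖curlM A y α β‖ ≤ ε) :
    ∃ a : PBond (F.P K) 0 → Matrix n n ℂ, (∀ b, a b ∈ S) ∧ linAvgIterM k a = A ∧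
      ∀ (z : Site (F.P K) 0) (μ ν : Fin 3), μ ≠ ν → z ∈ Ω → z.shift μ ∈ Ω → z.shift ν ∈ Ω → (z.shift μ).shift ν ∈ Ω →
        ‖curlM a z μ ν‖ ≤ (4800 * (((F.L : ℝ) ^ k)⁻¹) ^ 2) * ε :=
  ⟨liftRegionM Ω A, liftRegionM_mem Ω S hAS, linAvgIterM_liftRegionM Ω hk A,
    fun z μ ν hμν hz hzμ hzν hzμν => norm_curlM_liftRegionM_le Ω hk hΩ A hε hA z μ ν hμν hz hzμ hzν hzμν⟩

end MatrixRegion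

end Summit.QuantumFields.YangMills.Theorems.LinearLiftMatrix

end
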